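import Summits.ValiantsHypothesis.ValiantsHypothesis.Theorems.KPlusLogSqLawTropicalBTwoPermutations

/-!
# Route `KPlusLogSqLaw`, crux `TropicalB` (stmt-ValiantsHypothesis-19771) — the VALUED-BLOCK LAW:
# a column block with a chain-constant row image enters each of its restriction values at most once, so it changes at most
# `#values − 1` times; blocks seeing every step give `n ≤ Σ_t (#values_t − 1)` (gadgets with a fixed boundary are ADDITIVE)

HONEST FRAMING.  Helper file (seat val-sym-trop-p1 g14, cell `pub-symmetroid`, 2026-08-28) toward the registered stubs
`stub_tropThin` / `stub_tropFat` of `Cruxes/TropicalB/Lines/birth.lean` (crux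
`Summit.ValiantsHypothesis.ValiantsHypothesis.Theses.KPlusLogSqLaw.TropicalB`, item `stmt-ValiantsHypothesis-19771`, route
`KPlusLogSqLaw`; `--supports … --as helper`).  Sequel of `…TropicalBTwoPermutations` (binary blocks, p591144): the same exchange
argument for blocks with any finite number of restriction values.  A STRUCTURE law valid for every design; it bounds nothing for
`TropicalB` in its window and bears on neither `WeakLifting`, DoorA26/DoorA34, `MatrixDescartes` (stmt-ValiantsHypothesis-18050) nor
VP ≠ VNP.

THE LAW.  Let `p₀ ≺ ⋯ ≺ pₙ` be dominant at strictly increasing integer slopes and let `C` be a column set whose row image is the same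
for all terms of the chain (a «gadget with a fixed boundary»).  By the exchange principle (`TwoPermutations.sl_lt_of_chain`) two terms
with different restrictions to `C` have strictly increasing `C`-slope, so a restriction value, once left, is never re-entered, and the
initial value is never entered: the step `k ↦ restr C p_{k+1}` is INJECTIVE on the steps that change the block and avoids `restr C p₀`
(`enter_injective`, `enter_ne_init`).  Hence

* `card_changes_le` — if all restrictions of the chain to `C` lie in a finite set `V`, the block changes at most `#V − 1` times;
* `chain_le_sum_values` — if blocks `C_t` (`t < g`) with value sets `V_t` see every step (some block changes at each step), then
  `n ≤ Σ_t (#V_t − 1)`: gadgets with a fixed boundary contribute ADDITIVELY, each at most its number of states minus one — the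
  abstract form of «direct sums / registers with private boundaries add, never multiply» (memo ODOMETER-ANATOMY-g14 §6).
[folklore]-level (exchange principle + an injection).
-/

set_option linter.dupNamespace false
set_option autoImplicit false

namespace Summit.ValiantsHypothesis.ValiantsHypothesis.Theorems.KPlusLogSqLaw

open Summit.ValiantsHypothesis.ValiantsHypothesis.Theorems.MatrixDescartes.Negative
open scoped BigOperators
open Finset IntervalOpt

namespace ValuedBlocks

variable {m K : ℕ} {d : Fin K → ℕ} {v ε : Fin m → Fin m → Fin K → ℤ}

/-- **A value once left is never re-entered**: if two steps `k < k'` of the chain both ENTER the same restriction value on a block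
with a chain-constant image, contradiction; i.e. `k ↦ restr C p_{k+1}` is injective on changing steps. [folklore] -/
theorem enter_injective {n : ℕ} {θ : Fin (n + 1) → ℤ} {p : Fin (n + 1) → Equiv.Perm (Fin m) × (Fin m → Fin K)}
    (hθ : StrictMono θ) (hdom : ∀ k, IsDominant d v ε (θ k) (p k)) {C : Finset (Fin m)}
    (himg : ∀ k k', C.image (p k).1 = C.image (p k').1) {k k' : Fin n}
    (hk : restr C (p k.castSucc) ≠ restr C (p k.succ)) (hk' : restr C (p k'.castSucc) ≠ restr C (p k'.succ))
    (heq : restr C (p k.succ) = restr C (p k'.succ)) : k = k' := by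
  have key : ∀ k k' : Fin n, k < k' → restr C (p k'.castSucc) ≠ restr C (p k'.succ) →
      restr C (p k.succ) = restr C (p k'.succ) → False := by
    intro k k' hlt hk' heq
    have hle : k.succ ≤ k'.castSucc := by
      rw [Fin.le_iff_val_le_val, Fin.val_succ, Fin.val_castSucc]
      exact hlt
    have h2 : sl d C (p k'.castSucc) < sl d C (p k'.succ) :=
      TwoPermutations.sl_lt_of_chain hθ hdom himg (Fin.castSucc_lt_succ (i := k')) hk'
    rcases hle.lt_or_eq with hlt' | he
    · have hne : restr C (p k.succ) ≠ restr C (p k'.castSucc) := by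
        rw [heq]; exact fun h => hk' h.symm
      have h1 := TwoPermutations.sl_lt_of_chain hθ hdom himg hlt' hne
      have e := sl_congr (d := d) heq
      linarith
    · apply hk'
      rw [← he, heq]
  rcases lt_trichotomy k k' with h | h | h
  · exact (key k k' h hk' heq).elim
  · exact h
  · exact (key k' k h hk heq.symm).elim

/-- **The initial value is never entered.** [folklore] -/
theorem enter_ne_init {n : ℕ} {θ : Fin (n + 1) → ℤ} {p : Fin (n + 1) → Equiv.Perm (Fin m) × (Fin m → Fin K)}
    (hθ : StrictMono θ) (hdom : ∀ k, IsDominant d v ε (θ k) (p k)) {C : Finset (Fin m)}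
    (himg : ∀ k k', C.image (p k).1 = C.image (p k').1) {k : Fin n}
    (hk : restr C (p k.castSucc) ≠ restr C (p k.succ)) : restr C (p k.succ) ≠ restr C (p 0) := by
  intro heq
  have h2 : sl d C (p k.castSucc) < sl d C (p k.succ) :=
    TwoPermutations.sl_lt_of_chain hθ hdom himg (Fin.castSucc_lt_succ (i := k)) hk
  rcases (Fin.zero_le k.castSucc).lt_or_eq with hlt | he
  · have hne : restr C (p 0) ≠ restr C (p k.castSucc) := by
      rw [← heq]; exact fun h => hk h.symm
    have h1 := TwoPermutations.sl_lt_of_chain hθ hdom himg hlt hne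
    have e := sl_congr (d := d) heq
    linarith
  · apply hk
    rw [← he, heq]

/-- **VALUED-BLOCK LAW (one block).**  If the restrictions of the chain to a block `C` with chain-constant row image all lie in a finite
set `V`, then at most `#V − 1` steps change the block. [folklore] -/
theorem card_changes_le {n : ℕ} {θ : Fin (n + 1) → ℤ} {p : Fin (n + 1) → Equiv.Perm (Fin m) × (Fin m → Fin K)}
    (hθ : StrictMono θ) (hdom : ∀ k, IsDominant d v ε (θ k) (p k)) {C : Finset (Fin m)}
    (himg : ∀ k k', C.image (p k).1 = C.image (p k').1) (V : Finset (Fin m → Option (Fin m × Fin K)))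
    (hV : ∀ k, restr C (p k) ∈ V) :
    (Finset.univ.filter fun k : Fin n => restr C (p k.castSucc) ≠ restr C (p k.succ)).card ≤ V.card - 1 := by
  classical
  set S := Finset.univ.filter fun k : Fin n => restr C (p k.castSucc) ≠ restr C (p k.succ) with hS
  have hmem : ∀ k, k ∈ S ↔ restr C (p k.castSucc) ≠ restr C (p k.succ) := fun k => by
    rw [hS, Finset.mem_filter]; simp
  have h1 : S.card ≤ (V.erase (restr C (p 0))).card := by
    apply Finset.card_le_card_of_injOn (fun k => restr C (p k.succ))
    · intro k hk
      rw [Finset.mem_coe, hmem] at hk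
      rw [Finset.mem_coe, Finset.mem_erase]
      exact ⟨enter_ne_init hθ hdom himg hk, hV _⟩
    · intro k hk k' hk' h
      rw [Finset.mem_coe, hmem] at hk hk'
      exact enter_injective hθ hdom himg hk hk' h
  have h2 : (V.erase (restr C (p 0))).card = V.card - 1 := Finset.card_erase_of_mem (hV 0)
  omega

/-- **VALUED-BLOCK LAW (chain form).**  Blocks `C_t` (`t < g`) with chain-constant row images and finite value sets `V_t`; if every
step of the chain changes some block, then `n ≤ Σ_t (#V_t − 1)`: gadgets with a fixed boundary contribute additively. [folklore] -/
theorem chain_le_sum_values {n g : ℕ} {θ : Fin (n + 1) → ℤ} {p : Fin (n + 1) → Equiv.Perm (Fin m) × (Fin m → Fin K)}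
    (hθ : StrictMono θ) (hdom : ∀ k, IsDominant d v ε (θ k) (p k)) (C : Fin g → Finset (Fin m))
    (himg : ∀ t k k', (C t).image (p k).1 = (C t).image (p k').1)
    (V : Fin g → Finset (Fin m → Option (Fin m × Fin K))) (hV : ∀ t k, restr (C t) (p k) ∈ V t)
    (hcov : ∀ k : Fin n, ∃ t, restr (C t) (p k.castSucc) ≠ restr (C t) (p k.succ)) :
    n ≤ ∑ t, ((V t).card - 1) := by
  classical
  -- every step lies in the change set of some block
  have hcover : (Finset.univ : Finset (Fin n)) ⊆
      Finset.univ.biUnion fun t : Fin g => Finset.univ.filter fun k : Fin n =>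
        restr (C t) (p k.castSucc) ≠ restr (C t) (p k.succ) := by
    intro k _
    rw [Finset.mem_biUnion]
    obtain ⟨t, ht⟩ := hcov k
    exact ⟨t, Finset.mem_univ t, by rw [Finset.mem_filter]; exact ⟨Finset.mem_univ k, ht⟩⟩
  calc n = (Finset.univ : Finset (Fin n)).card := by simp
    _ ≤ (Finset.univ.biUnion fun t : Fin g => Finset.univ.filter fun k : Fin n =>
          restr (C t) (p k.castSucc) ≠ restr (C t) (p k.succ)).card := Finset.card_le_card hcover
    _ ≤ ∑ t, (Finset.univ.filter fun k : Fin n => restr (C t) (p k.castSucc) ≠ restr (C t) (p k.succ)).card :=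
          Finset.card_biUnion_le
    _ ≤ ∑ t, ((V t).card - 1) := Finset.sum_le_sum fun t _ => card_changes_le hθ hdom (himg t) (V t) (hV t)

end ValuedBlocks

end Summit.ValiantsHypothesis.ValiantsHypothesis.Theorems.KPlusLogSqLaw
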